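import Literature.NumberTheory.EllipticCurves.LeadingTermBSZNonsplitDensityProofs
import HarnessLib

/-!
# `ord₅` and the unit part modulo `25` of `4A³ + 27B²` only depend on `(A, B)` modulo `5^{K+2}`
# (on the truncation `ord₅ ≤ K`) — the congruence invariance behind the `5`-adic cells of the pieces

Theorems only (no definition, no named fact; D-0014 / D-0026, debt `+0`).

Bhargava–Skinner–Zhang (arXiv:1407.1826v2, §3.1–3.2 and the proof of Lemma 18, pp. 8–9) define
`S₀(5)`, `S₁'(5)`, `S₁(5)` "by congruence conditions" at `5`: membership of `E_{A,B}` is read off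
`A mod 5`, `k = ord₅(4A³ + 27B²)` and the class of `(4A³ + 27B²)/5^k` modulo `25` ("`Δ(A,B)/p^k ∉ S_k
(mod p²)`", p. 9). For the TRUNCATED pieces (`ord₅ ≤ K`; the tree's `Pieces.S₁'Trunc K`, `T₅Trunc K`,
`SP' K`) these data only depend on `(A, B)` modulo `5^{K+2}`, which is what makes them finite unions of
`5`-adic cells `discFamily 5 (K+2) a b` — the shape in which Bhargava–Shankar's large-family theorems
(`CongruenceFamily`, A330) and Bhargava–Skinner's equidistribution (A329, `…_residues`) are consumed.
This file proves the elementary congruence facts, for the prime `5` of the application: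

* `disc_modEq_of_modEq` — `A ≡ A'`, `B ≡ B' (mod m)` ⟹ `4A³+27B² ≡ 4A'³+27B'² (mod m)`;
* `padicValInt_five_eq_of_modEq` — `D ≡ D' (mod 5^n)`, `D' ≠ 0`, `ord₅ D' < n` ⟹ `ord₅ D = ord₅ D'`;
* `padicValInt_five_le_iff_of_modEq` — `D ≡ D' (mod 5^n)`, both nonzero, `K < n` ⟹
  (`ord₅ D ≤ K ⟺ ord₅ D' ≤ K`);
* `div_pow_padicValInt_five_modEq_of_modEq` — `D ≡ D' (mod 5^n)`, `D' ≠ 0`, `ord₅ D' + e ≤ n` ⟹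
  `D/5^{ord₅ D'} ≡ D'/5^{ord₅ D'} (mod 5^e)`;
* `intCast_zmod_eq_of_modEq_pow` — `A ≡ A' (mod 5^n)`, `j ≤ n` ⟹ `(A : ZMod (5^j)) = A'`.

## References

* M. Bhargava, C. Skinner, W. Zhang, arXiv:1407.1826v2 (2014), §3.1–3.2 (p. 8: "defined by congruence
  conditions") and proof of Lemma 18 (p. 9). [cite: BhargavaSkinnerZhang2014, §3.1–3.2 and Lemma 18 (proof)]
-/

set_option autoImplicit false

namespace Literature.NumberTheory.EllipticCurves

namespace PadicValFive

/-- `(A, B) ↦ 4A³ + 27B²` respects congruences (the discriminant condition of the source's congruence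
sets). [cite: BhargavaSkinnerZhang2014, §3.1–3.2 (p. 8: sets of curves E_{A,B} defined by congruence conditions)] -/
theorem disc_modEq_of_modEq {A A' B B' m : ℤ} (hA : A ≡ A' [ZMOD m]) (hB : B ≡ B' [ZMOD m]) :
    4 * A ^ 3 + 27 * B ^ 2 ≡ 4 * A' ^ 3 + 27 * B' ^ 2 [ZMOD m] :=
  ((hA.pow 3).mul_left 4).add ((hB.pow 2).mul_left 27)

/-- Residues modulo a smaller power: `A ≡ A' (mod 5^n)`, `j ≤ n` ⟹ `(A : ZMod 5^j) = (A' : ZMod 5^j)`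
(a condition modulo `5^j` is a condition modulo `5^n`).
[cite: BhargavaSkinnerZhang2014, §3.1–3.2 (p. 8: congruence conditions at 5)] -/
theorem intCast_zmod_eq_of_modEq_pow {A A' : ℤ} {n j : ℕ} (h : A ≡ A' [ZMOD (5 : ℤ) ^ n])
    (hj : j ≤ n) : (A : ZMod (5 ^ j)) = (A' : ZMod (5 ^ j)) := by
  rw [ZMod.intCast_eq_intCast_iff]
  push_cast
  exact h.of_dvd (pow_dvd_pow (5 : ℤ) hj)

/-- **`ord₅` is a congruence invariant below the modulus**: `D ≡ D' (mod 5^n)`, `D' ≠ 0` and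
`ord₅ D' < n` imply `ord₅ D = ord₅ D'` (write `D' = 5^v·u`, `5 ∤ u`; then `D = 5^v·(u + 5^{n-v}·t)`).
[cite: BhargavaSkinnerZhang2014, §3.1–3.2 (p. 8: the sets are defined by congruence conditions)] -/
theorem padicValInt_five_eq_of_modEq {D D' : ℤ} {n : ℕ} (h : D ≡ D' [ZMOD (5 : ℤ) ^ n])
    (hD' : D' ≠ 0) (hv : padicValInt 5 D' < n) : padicValInt 5 D = padicValInt 5 D' := by
  set v := padicValInt 5 D' with hvdef
  obtain ⟨hv1, hv2⟩ := dvd_and_not_dvd_padicValInt hD'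
  -- `D = D' + 5^n t`
  obtain ⟨t, ht⟩ := (Int.ModEq.dvd h.symm : ((5 : ℤ) ^ n) ∣ D - D')
  have hD : D = D' + (5 : ℤ) ^ n * t := by linear_combination ht
  have hvn : (5 : ℤ) ^ v ∣ (5 : ℤ) ^ n := pow_dvd_pow (5 : ℤ) hv.le
  have hvn1 : (5 : ℤ) ^ (v + 1) ∣ (5 : ℤ) ^ n := pow_dvd_pow (5 : ℤ) (by omega)
  refine padicValInt_eq_of_dvd_of_not_dvd ?_ ?_
  · rw [hD]; exact dvd_add hv1 (hvn.mul_right t)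
  · rw [hD]
    intro h1
    exact hv2 ((dvd_add_left (hvn1.mul_right t)).mp h1)

/-- The truncation `ord₅ ≤ K` is a congruence condition modulo `5^n`, `n > K`.
[cite: BhargavaSkinnerZhang2014, §3.1–3.2 (p. 8) and Lemma 18 (proof, p. 9: ord_p(Δ(A,B)) = k read modulo p^{k+2})] -/
theorem padicValInt_five_le_iff_of_modEq {D D' : ℤ} {n K : ℕ} (h : D ≡ D' [ZMOD (5 : ℤ) ^ n])
    (hD : D ≠ 0) (hD' : D' ≠ 0) (hK : K < n) :
    padicValInt 5 D ≤ K ↔ padicValInt 5 D' ≤ K := by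
  constructor
  · intro hle
    rw [padicValInt_five_eq_of_modEq h.symm hD (by omega)]
    exact hle
  · intro hle
    rw [padicValInt_five_eq_of_modEq h hD' (by omega)]
    exact hle

/-- **The unit part modulo `5^e` is a congruence invariant**: `D ≡ D' (mod 5^n)`, `D' ≠ 0`,
`ord₅ D' + e ≤ n` imply `D/5^{ord₅ D'} ≡ D'/5^{ord₅ D'} (mod 5^e)` (and `ord₅ D = ord₅ D'` when `e ≥ 1`).
With `e = 2` this is the invariance of the class "`Δ(A,B)/5^k (mod 25)`" of the proof of Lemma 18.
[cite: BhargavaSkinnerZhang2014, Lemma 18 (proof, p. 9: Δ(A,B)/p^k mod p²)] -/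
theorem div_pow_padicValInt_five_modEq_of_modEq {D D' : ℤ} {n e : ℕ}
    (h : D ≡ D' [ZMOD (5 : ℤ) ^ n]) (hD' : D' ≠ 0) (he : padicValInt 5 D' + e ≤ n) :
    D / (5 : ℤ) ^ padicValInt 5 D' ≡ D' / (5 : ℤ) ^ padicValInt 5 D' [ZMOD (5 : ℤ) ^ e] := by
  set v := padicValInt 5 D' with hvdef
  obtain ⟨hv1, -⟩ := dvd_and_not_dvd_padicValInt hD'
  obtain ⟨u, hu⟩ := hv1
  obtain ⟨t, ht⟩ := (Int.ModEq.dvd h.symm : ((5 : ℤ) ^ n) ∣ D - D')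
  have h5v : (5 : ℤ) ^ v ≠ 0 := pow_ne_zero _ (by norm_num)
  have hD : D = (5 : ℤ) ^ v * (u + (5 : ℤ) ^ (n - v) * t) := by
    have hn : n = v + (n - v) := by omega
    have : (5 : ℤ) ^ n = (5 : ℤ) ^ v * (5 : ℤ) ^ (n - v) := by rw [← pow_add, ← hn]
    linear_combination ht + hu + this * t
  rw [hD, hu, Int.mul_ediv_cancel_left _ h5v, Int.mul_ediv_cancel_left _ h5v]
  have he' : (5 : ℤ) ^ e ∣ (5 : ℤ) ^ (n - v) := pow_dvd_pow (5 : ℤ) (by omega)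
  calc u + (5 : ℤ) ^ (n - v) * t ≡ u + 0 [ZMOD (5 : ℤ) ^ e] :=
        Int.ModEq.add_left u ((Int.modEq_zero_iff_dvd.mpr (he'.mul_right t)))
    _ = u := add_zero u

end PadicValFive

end Literature.NumberTheory.EllipticCurves
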